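import Mathlib
import HarnessLib
import Literature.MathematicalPhysics.StatisticalMechanics.RenormalisationStepAlgebra
import Literature.MathematicalPhysics.StatisticalMechanics.RelevantProjectionContraction
import Literature.MathematicalPhysics.StatisticalMechanics.TorusNeighbourhoods

/-!
# Locality of the renormalised perturbation: `K_{k+1}(U, ·)` depends only on the field gradients
# on `U*` ([ABKM19] Lemma 6.4 (2)–(3))

[ABKM19] Lemma 6.4 (2): if `K(X, ·)` depends only on the field on the small-set neighbourhood `X*`
(and `H, H̃ ∈ M_0`), then `K_{k+1}(U, ·)` of Definition 6.5 / (6.34) depends only on the field on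
`U*`; (3): shift invariance is likewise inherited.  We phrase locality by the tree's
`IsGaugeLocal (fieldGauge 𝔥 R p S) F` (`F φ = F ψ` whenever all `∇^α φ(x) = ∇^α ψ(x)`, `x ∈ S`,
`1 ≤ |α| ≤ p`) — the notion the norms `‖·‖_{k,X,T_φ}` of Ch. 6.4 are built on
(`TaylorPolynomialNorms`, `GradientFieldNorms`); it contains both locality on (a `p`-thickening
of) `S` and shift invariance, i.e. it is the "functional of `∇φ|_{E(S)}`" form of Lemma 6.3.

* bookkeeping for `IsGaugeLocal` with field gauges: independence of the weights `𝔥, R`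
  (`isGaugeLocal_fieldGauge_iff`), monotonicity in the set (`IsGaugeLocal.fieldGauge_mono`),
  closure under `+, −, *, ⁻¹, Σ, ∏`, fluctuation shifts `φ ↦ F(φ + ξ)` and `dμ(ξ)`-integrals;
* `isGaugeLocal_bprod`, `isGaugeLocal_pcirc`, `isGaugeLocal_midK` — the building blocks of (6.34);
* **`isGaugeLocal_nextK`** — Lemma 6.4 (2)–(3): given a reblocking map `π` with
  `X + [−r,r]^d ⊆ π(X) + [−r',r']^d` ((6.28), `ReblockingNeighbourhoods.thicken_subset_thicken_reblock`
  for the map of (6.25)–(6.26)), one-block functionals `I(B,·), Ĩ(B,·)` local on every `S ⊇ B`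
  (e.g. `e^{−H(B,·)}`, `isGaugeLocal_cexp_neg_eval`, from `isGaugeLocal_eval`), and `K(Y, ·)`
  local on `Y + [−r,r]^d` for every `k`-polymer `Y`, the functional `K_{k+1}(U, ·) = nextK … U`
  is local on `U + [−r',r']^d`.

Everything is proved; no named fact.

## References
* S. Adams, S. Buchholz, R. Kotecký, S. Müller, arXiv:1910.13564, Lemma 6.3, Lemma 6.4 (2)–(3)
  and its proof, (6.28) [AdamsBuchholzKoteckyMuller2019].
-/

noncomputable section

namespace Literature.MathematicalPhysics.StatisticalMechanics.GradientRG

open scoped BigOperators Classical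
open Finset MeasureTheory
open Literature.MathematicalPhysics.StatisticalMechanics.TorusPolymer
open Literature.MathematicalPhysics.StatisticalMechanics.GradientFRD (iterDiff)

variable {d M : ℕ} [NeZero M]

/-! ## `IsGaugeLocal` bookkeeping for field gauges -/

section Gauge

variable {𝔸 : Type*}

omit [NeZero M] in
/-- Two fields have the same gauge iff all their derivatives `∇^α`, `1 ≤ |α| ≤ p`, agree on `S`
(the weights `𝔥⁻¹ R^{|α|}` are non-zero). [cite: AdamsBuchholzKoteckyMuller2019, Ch. 6.4 (6.40)] -/
theorem fieldGauge_eq_iff {𝔥 R : ℝ} (h𝔥 : 𝔥 ≠ 0) (hR : R ≠ 0) {p : ℕ} {S : Finset (Fin d → ZMod M)}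
    {φ ψ : (Fin d → ZMod M) → ℝ} :
    fieldGauge 𝔥 R p S φ = fieldGauge 𝔥 R p S ψ ↔
      ∀ x ∈ S, ∀ α ∈ diffIndex d p, iterDiff α φ x = iterDiff α ψ x := by
  constructor
  · intro h x hx α hα
    have := congrFun h (⟨x, hx⟩, ⟨α, hα⟩)
    rw [fieldGauge_apply, fieldGauge_apply] at this
    exact mul_left_cancel₀ (mul_ne_zero (inv_ne_zero h𝔥) (pow_ne_zero _ hR)) this
  · intro h
    funext q
    rw [fieldGauge_apply, fieldGauge_apply, h q.1 q.1.2 q.2 q.2.2]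

/-- **Gauge locality does not depend on the weights `𝔥, R`** (non-zero).
[cite: AdamsBuchholzKoteckyMuller2019, Ch. 6.4 (6.40)] -/
theorem isGaugeLocal_fieldGauge_iff {𝔥 R 𝔥' R' : ℝ} (h𝔥 : 𝔥 ≠ 0) (hR : R ≠ 0) (h𝔥' : 𝔥' ≠ 0)
    (hR' : R' ≠ 0) {p : ℕ} {S : Finset (Fin d → ZMod M)} {F : ((Fin d → ZMod M) → ℝ) → 𝔸} :
    IsGaugeLocal (fieldGauge 𝔥 R p S) F ↔ IsGaugeLocal (fieldGauge 𝔥' R' p S) F := by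
  constructor
  · intro h φ ψ hT
    exact h φ ψ ((fieldGauge_eq_iff h𝔥 hR).2 ((fieldGauge_eq_iff h𝔥' hR').1 hT))
  · intro h φ ψ hT
    exact h φ ψ ((fieldGauge_eq_iff h𝔥' hR').2 ((fieldGauge_eq_iff h𝔥 hR).1 hT))

/-- **Monotonicity in the set**: locality on `S` implies locality on every `S' ⊇ S`.
[cite: AdamsBuchholzKoteckyMuller2019, Lemma 6.4 (2) (proof: "the ∗ operation is monotone")] -/
theorem IsGaugeLocal.fieldGauge_mono {𝔥 R : ℝ} (h𝔥 : 𝔥 ≠ 0) (hR : R ≠ 0) {p : ℕ}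
    {S S' : Finset (Fin d → ZMod M)} (hSS' : S ⊆ S') {F : ((Fin d → ZMod M) → ℝ) → 𝔸}
    (hF : IsGaugeLocal (fieldGauge 𝔥 R p S) F) : IsGaugeLocal (fieldGauge 𝔥 R p S') F := by
  intro φ ψ hT
  refine hF φ ψ ((fieldGauge_eq_iff h𝔥 hR).2 fun x hx α hα => ?_)
  exact (fieldGauge_eq_iff h𝔥 hR).1 hT x (hSS' hx) α hα

variable {E V : Type*} [NormedAddCommGroup E] [NormedSpace ℝ E] [NormedAddCommGroup V]
  [NormedSpace ℝ V]

/-- Constants are local. [cite: AdamsBuchholzKoteckyMuller2019, Lemma 6.3] -/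
theorem isGaugeLocal_const (T : E →ₗ[ℝ] V) (c : 𝔸) : IsGaugeLocal T fun _ => c := fun _ _ _ => rfl

/-- Locality is closed under pointwise binary operations. [cite: AdamsBuchholzKoteckyMuller2019, Lemma 6.3] -/
theorem IsGaugeLocal.op₂ {𝔹 ℂ' : Type*} (T : E →ₗ[ℝ] V) {F : E → 𝔸} {G : E → 𝔹} (op : 𝔸 → 𝔹 → ℂ')
    (hF : IsGaugeLocal T F) (hG : IsGaugeLocal T G) : IsGaugeLocal T fun φ => op (F φ) (G φ) :=
  fun φ ψ h => by simp only [hF φ ψ h, hG φ ψ h]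

/-- Locality is closed under pointwise unary operations. [cite: AdamsBuchholzKoteckyMuller2019, Lemma 6.3] -/
theorem IsGaugeLocal.op₁ {𝔹 : Type*} (T : E →ₗ[ℝ] V) {F : E → 𝔸} (op : 𝔸 → 𝔹)
    (hF : IsGaugeLocal T F) : IsGaugeLocal T fun φ => op (F φ) :=
  fun φ ψ h => by simp only [hF φ ψ h]

/-- Finite sums of local functionals are local. [cite: AdamsBuchholzKoteckyMuller2019, Lemma 6.3] -/
theorem isGaugeLocal_finset_sum [AddCommMonoid 𝔸] {ι : Type*} (T : E →ₗ[ℝ] V) (s : Finset ι)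
    {F : ι → E → 𝔸} (hF : ∀ i ∈ s, IsGaugeLocal T (F i)) : IsGaugeLocal T fun φ => ∑ i ∈ s, F i φ :=
  fun φ ψ h => Finset.sum_congr rfl fun i hi => hF i hi φ ψ h

/-- Finite products of local functionals are local. [cite: AdamsBuchholzKoteckyMuller2019, Lemma 6.3] -/
theorem isGaugeLocal_finset_prod [CommMonoid 𝔸] {ι : Type*} (T : E →ₗ[ℝ] V) (s : Finset ι)
    {F : ι → E → 𝔸} (hF : ∀ i ∈ s, IsGaugeLocal T (F i)) : IsGaugeLocal T fun φ => ∏ i ∈ s, F i φ :=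
  fun φ ψ h => Finset.prod_congr rfl fun i hi => hF i hi φ ψ h

/-- **Fluctuation shifts preserve locality**: `φ ↦ F(φ + ξ)` is local when `F` is (`T` linear).
[cite: AdamsBuchholzKoteckyMuller2019, Lemma 6.4 (2) (proof: "R preserves locality")] -/
theorem IsGaugeLocal.comp_add_right (T : E →ₗ[ℝ] V) {F : E → 𝔸} (hF : IsGaugeLocal T F) (ξ : E) :
    IsGaugeLocal T fun φ => F (φ + ξ) :=
  fun φ ψ h => hF _ _ (by rw [map_add, map_add, h])

/-- **Integration over the fluctuation field preserves locality**: `φ ↦ ∫ G(φ, ξ) dμ(ξ)` is local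
when every `G(·, ξ)` is. [cite: AdamsBuchholzKoteckyMuller2019, Lemma 6.4 (2)] -/
theorem isGaugeLocal_integral [NormedAddCommGroup 𝔸] [NormedSpace ℝ 𝔸] {Ω : Type*} [MeasurableSpace Ω]
    (T : E →ₗ[ℝ] V) (μ : Measure Ω) {G : E → Ω → 𝔸} (hG : ∀ ξ, IsGaugeLocal T fun φ => G φ ξ) :
    IsGaugeLocal T fun φ => ∫ ξ, G φ ξ ∂μ :=
  fun φ ψ h => by
    have : (fun ξ => G φ ξ) = fun ξ => G ψ ξ := funext fun ξ => hG ξ φ ψ h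
    show ∫ ξ, G φ ξ ∂μ = ∫ ξ, G ψ ξ ∂μ
    rw [this]

end Gauge

/-! ## The building blocks of (6.34) -/

section Blocks

variable {𝕜 : Type*} [RCLike 𝕜] {E V : Type*} [NormedAddCommGroup E] [NormedSpace ℝ E]
  [NormedAddCommGroup V] [NormedSpace ℝ V]

/-- Block products of local one-block functionals are local. [cite: AdamsBuchholzKoteckyMuller2019, Lemma 6.4 (2)] -/
theorem isGaugeLocal_bprod (T : E →ₗ[ℝ] V) {s : ℕ} {F : Finset (Fin d → ZMod M) → E → 𝕜}
    {X : Finset (Fin d → ZMod M)} (hF : ∀ B ∈ blocks s X, IsGaugeLocal T (F B)) :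
    IsGaugeLocal T fun φ => bprod s (fun B => F B φ) X :=
  isGaugeLocal_finset_prod T (blocks s X) hF

/-- Circle products of local functionals are local. [cite: AdamsBuchholzKoteckyMuller2019, Lemma 6.4 (2)] -/
theorem isGaugeLocal_pcirc (T : E →ₗ[ℝ] V) {s : ℕ} {F G : Finset (Fin d → ZMod M) → E → 𝕜}
    {X : Finset (Fin d → ZMod M)} (hF : ∀ Y ∈ polys s X, IsGaugeLocal T (F Y))
    (hG : ∀ Y ∈ polys s X, IsGaugeLocal T (G (X \ Y))) :
    IsGaugeLocal T fun φ => pcirc s (fun Y => F Y φ) (fun Y => G Y φ) X :=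
  isGaugeLocal_finset_sum T (polys s X) fun Y hY => (hF Y hY).op₂ T (· * ·) (hG Y hY)

end Blocks

/-! ## Lemma 6.4 (2)–(3) -/

section Locality

variable {𝕜 : Type*} [RCLike 𝕜]

/-- **`e^{−H(B,·)}` is local on every `S ⊇ B`** (`p ≥ ⌊d/2⌋+1`, `𝕜 = ℂ`): relevant Hamiltonians see
only `∇^α φ(x)`, `x ∈ B`, `|α| ≤ ⌊d/2⌋+1`. [cite: AdamsBuchholzKoteckyMuller2019, Ch. 6.2 (M_0 ⊂ M(𝓑_k))] -/
theorem isGaugeLocal_cexp_neg_eval {𝔥 R : ℝ} (h𝔥 : 𝔥 ≠ 0) (hR : R ≠ 0) {p : ℕ} (hp : d / 2 + 1 ≤ p)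
    {S B : Finset (Fin d → ZMod M)} (hBS : B ⊆ S) (H : RelevantHamiltonian ℂ d) :
    IsGaugeLocal (fieldGauge 𝔥 R p S) fun φ : (Fin d → ZMod M) → ℝ => Complex.exp (-(eval H B φ)) :=
  IsGaugeLocal.op₁ _ (fun z => Complex.exp (-z)) (isGaugeLocal_eval h𝔥 hR hp hBS H)

/-- **The intermediate functional `Φ(X, ·, ξ)` is local** on any `S` containing `X` on which the
pieces are local. [cite: AdamsBuchholzKoteckyMuller2019, Lemma 6.4 (2)] -/
theorem isGaugeLocal_midK {𝔥 R : ℝ} {p : ℕ} {S : Finset (Fin d → ZMod M)} {s : ℕ}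
    {I It K : Finset (Fin d → ZMod M) → ((Fin d → ZMod M) → ℝ) → 𝕜} {X : Finset (Fin d → ZMod M)}
    (hX : IsPolymer s X)
    (hI : ∀ B ∈ blocks s X, IsGaugeLocal (fieldGauge 𝔥 R p S) (I B))
    (hIt : ∀ B ∈ blocks s X, IsGaugeLocal (fieldGauge 𝔥 R p S) (It B))
    (hK : ∀ Y ∈ polys s X, IsGaugeLocal (fieldGauge 𝔥 R p S) (K Y)) (ξ : (Fin d → ZMod M) → ℝ) :
    IsGaugeLocal (fieldGauge 𝔥 R p S) fun φ => midK s I It K X φ ξ := by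
  unfold midK
  have hblocks : ∀ Y ∈ polys s X, blocks s Y ⊆ blocks s X :=
    fun Y hY => blocks_mono s (mem_polys.1 hY).1
  have hsd : ∀ Y ∈ polys s X, X \ Y ∈ polys s X :=
    fun Y hY => mem_polys.2 ⟨sdiff_subset, hX.sdiff (mem_polys.1 hY).2⟩
  refine isGaugeLocal_pcirc _ (fun Y hY => isGaugeLocal_bprod _ fun B hB =>
      (isGaugeLocal_const _ (1 : 𝕜)).op₂ _ (· - ·) (hIt B (hblocks Y hY hB))) ?_
  intro Y hY
  have hXY := hsd Y hY
  refine isGaugeLocal_pcirc _ (fun Z hZ => isGaugeLocal_bprod _ fun B hB => ?_) ?_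
  · have hZX : Z ∈ polys s X := polys_mono s sdiff_subset hZ
    exact ((hI B (hblocks Z hZX hB)).comp_add_right _ ξ).op₂ _ (· - ·) (isGaugeLocal_const _ (1 : 𝕜))
  · intro Z hZ
    have hW : (X \ Y) \ Z ∈ polys s X :=
      mem_polys.2 ⟨sdiff_subset.trans sdiff_subset, (mem_polys.1 hXY).2.sdiff (mem_polys.1 hZ).2⟩
    exact (hK _ hW).comp_add_right _ ξ

/-- **Lemma 6.4 (2)–(3): `K_{k+1}(U, ·)` is local on `U + [−r',r']^d`.**  Hypotheses: odd block
sides `s`, `s' = L s`; a reblocking map `π` with `π(X) ∈ 𝓟_{k+1}` and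
`X + [−r,r]^d ⊆ π(X) + [−r',r']^d` for `k`-polymers `X` ((6.28)); one-block functionals `I, Ĩ`
local on every set containing the block (relevant Hamiltonians: `isGaugeLocal_cexp_neg_eval`);
`K(Y, ·)` local on `Y + [−r,r]^d` for every `k`-polymer `Y`.
[cite: AdamsBuchholzKoteckyMuller2019, Lemma 6.4 (2)–(3)] -/
theorem isGaugeLocal_nextK {𝔥 R : ℝ} (h𝔥 : 𝔥 ≠ 0) (hR : R ≠ 0) {p : ℕ} {s L r r' : ℕ}
    (hs : Odd s) (hL : Odd L) {π : Finset (Fin d → ZMod M) → Finset (Fin d → ZMod M)}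
    (hπ : ∀ X, IsPolymer s X → IsPolymer (L * s) (π X))
    (hπr : ∀ X, IsPolymer s X → thicken r X ⊆ thicken r' (π X))
    (μ : Measure ((Fin d → ZMod M) → ℝ))
    {I It K : Finset (Fin d → ZMod M) → ((Fin d → ZMod M) → ℝ) → 𝕜}
    (hI : ∀ B S, B ⊆ S → IsGaugeLocal (fieldGauge 𝔥 R p S) (I B))
    (hIt : ∀ B S, B ⊆ S → IsGaugeLocal (fieldGauge 𝔥 R p S) (It B))
    (hK : ∀ Y, IsPolymer s Y → IsGaugeLocal (fieldGauge 𝔥 R p (thicken r Y)) (K Y))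
    (U : Finset (Fin d → ZMod M)) :
    IsGaugeLocal (fieldGauge 𝔥 R p (thicken r' U)) fun φ => nextK s π μ I It K U φ := by
  unfold nextK
  refine isGaugeLocal_finset_sum _ _ fun X hX => ?_
  obtain ⟨hXf, hπX⟩ := Finset.mem_filter.1 hX
  have hXp : IsPolymer s X := (mem_polys.1 hXf).2
  have hUp : IsPolymer s U := by rw [← hπX]; exact (hπ X hXp).of_mul hs hL
  -- the three regions are inside `U + [−r',r']^d`
  have hUS : U ⊆ thicken r' U := subset_thicken r' U
  have hXS : X ⊆ thicken r' U := by
    rw [← hπX]; exact (subset_thicken r X).trans (hπr X hXp)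
  have hXrS : thicken r X ⊆ thicken r' U := by rw [← hπX]; exact hπr X hXp
  refine (IsGaugeLocal.op₂ _ (· * ·) (isGaugeLocal_bprod _ fun B hB => hIt B _ ?_)
    ((isGaugeLocal_bprod _ fun B hB => hIt B _ ?_).op₁ _ fun z : 𝕜 => z⁻¹)).op₂ _ (· * ·) ?_
  · exact ((hUp.sdiff hXp).subset_of_mem_blocks hB).trans (sdiff_subset.trans hUS)
  · exact ((hXp.sdiff hUp).subset_of_mem_blocks hB).trans (sdiff_subset.trans hXS)
  · refine isGaugeLocal_integral _ μ fun ξ => isGaugeLocal_midK hXp (fun B hB => hI B _ ?_)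
      (fun B hB => hIt B _ ?_) (fun Y hY => ?_) ξ
    · exact (hXp.subset_of_mem_blocks hB).trans hXS
    · exact (hXp.subset_of_mem_blocks hB).trans hXS
    · have hYp := (mem_polys.1 hY).2
      exact (hK Y hYp).fieldGauge_mono h𝔥 hR ((thicken_mono r (mem_polys.1 hY).1).trans hXrS)

end Locality

end Literature.MathematicalPhysics.StatisticalMechanics.GradientRG

end
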